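import Literature.Probability.Percolation.CorrelationLengthDKTAssembly
import Literature.Probability.Percolation.NonBacktrackingPathCounting
import HarnessLib

/-!
# Duminil-Copin–Panis (2025), the "φ_β method" for spread-out percolation: its three printed
# quantitative levers, evaluated verbatim on NEAREST-NEIGHBOUR `ℤ^d` — no contraction at the
# blocks touching the slab (every `d`), Simon–Lieb depth `T < 2d`, and no equal-time coupling

CITATION HEADER. Source: H. Duminil-Copin, R. Panis, *An alternative approach for the mean-field
behaviour of spread-out Bernoulli percolation in dimensions `d > 6`*, Probab. Theory Related Fields
**195** (2025) 585–657, doi:10.1007/s00440-025-01416-2 = arXiv:2410.03647v2 (25 Jul 2025), REFEREED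
(bib key `DuminilCopinPanis2025Percolation`; held as `lit paper:arxiv-2410.03647`; theorem and
equation numbers and page numbers below are those of the arXiv v2 PDF, 60 pp.; TeX line numbers refer
to the e-print source `mainv17PERCOLATION.tex`). Origin: build `lace`, unit `b2b-lace-dmps-g10` (the
"DMPS route" seat, tenth generation; companion directory `…DuminilCopinMarkarPanisSlade2026`, whose
`KeyFloor`/`AssumptionIIRefuted` modules place the OTHER non-lace scheme, the random-walk black box of
arXiv:2605.21438, for the nearest-neighbour model).

WHAT THE PAPER PROVES, AND DOES NOT CLAIM. The model (§1.1, pp. 2–3): `p_{uv,β} = 1 - exp(-β J_{uv})`,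
`J_{uv} = c_L 𝟙_{1 ≤ |u-v| ≤ L}` with `|·|` the `ℓ^∞` norm (p. 2), `|J| = 1`;
`φ_β(S) := Σ_{y ∈ S, z ∉ S} P_β[0 ↔_S y] p_{yz,β}` (p. 3). Theorem 1.1 (p. 3): for `d > 6` there are
`C, L₀ > 0` such that for every `L ≥ L₀` … — a SPREAD-OUT statement with a non-explicit `L₀`; the
introduction (p. 1) restates the nearest-neighbour status as `d > 10` [HS90, Har08, FvdH17] and claims
nothing new for it. (Its `L = 1` member is the range-one BOX model with `3^d - 1` neighbours, not
nearest-neighbour `ℤ^d`.) Nothing in this file contradicts or weakens anything the paper states.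

WHAT THIS FILE RECORDS (statement level; the cell's "door census" for `d = 10, 11`). The scheme has
three quantitative levers whose printed form does not involve the range `L` except through the value
`φ_β({0})` (resp. `φ_β(B)`) and the step law `J` of the auxiliary random walk. We copy each as an
inequality between real numbers / a statement about walks, and evaluate it with `J := J_NN`
(`p_{yz} = p` on the `2d` lattice edges), where `φ_β` becomes the tree's `DCT16.phi p`
(Duminil-Copin–Tassion's `φ_p(S)`, same display) and `φ_p({0}) = 2dp` (`DKT20.phi_singleton_zero`):

* F1 — BLOCK-INDUCTION STEP, Lemma 3.5 (p. 20), proof, display (3.21) (p. 21; TeX l.976–978): for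
  `v` with `v₁ ≥ 1` and `B := Λ_{v₁-1}(v)`,
  `Σ_{r ∈ B, s ∉ B ∪ H⁻} P_β[v ↔_B r] p_{rs,β} ≤ (2d-1)/(2d) · φ_β(B) ≤ (1 - 1/(2d))(1 + K/L^d) ≤ 1 - 1/(4d²)`,
  the middle step being Proposition 3.3 (p. 18) with `K/L₂^d ≤ 1/(2d)` (p. 21, TeX l.972). The
  induction (3.20) runs over ALL `v ∈ Λ⁺_{n_ℓ}`, so the sites with `v₁ = 1` — block `B = Λ₀(v) = {v}`,
  a singleton — are load-bearing, and there the left-hand side is exactly `(2d-1) p`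
  (`2d - 1` of the `2d` edges at `v` leave `B` away from `H⁻`). `BlockStep d θ Φ` is the inequality
  `(2d-1)/(2d) · Φ ≤ θ`; the paper's `θ` is `contractionFactor d = 1 - 1/(4d²)`, and any `θ < 1` would
  serve its purpose (a geometric gain per level, (3.22)). NEAREST-NEIGHBOUR VALUE: for EVERY `d ≥ 1`
  and EVERY `θ < 1` the step fails on the whole interval `(θ/(2d-1), p_c]` of densities
  (`not_blockStep_singleton_of_lt`, `noContraction_near_criticalProbI`), because
  `(2d-1) p_c ≥ 1` (`p_c ≥ 1/(2d-1)`, the tree's `inv_le_criticalProbI`); with the printed `θ`: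
  on `((2d+1)/(4d²), p_c]`, i.e. `(0.0525, p_c(ℤ¹⁰)]` resp. `(0.04752…, p_c(ℤ¹¹)]`
  (`printedThreshold_ten/eleven`, `1/19 = 0.0526…`, `1/21 = 0.0476…`).
* F2 — SIMON–LIEB DEPTH, Lemma 3.8 (p. 23) iterated `T` times, proof of Proposition 3.6 (pp. 24–25,
  TeX l.1100–1120): `P_β[u ↔ x] ≤ φ^T · E^{RW}_u[P_β[X^u_T ↔ x]]` with `φ := φ_β({0})`, and "we may choose
  `L₃` … such that … `φ^T ≤ 2`" (p. 25). `DepthCap φ T` is `φ^T ≤ 2`. NEAREST-NEIGHBOUR VALUE: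
  `φ_{p_c}({0}) = 2d p_c ≥ 2d/(2d-1) = 1 + 1/(2d-1)`, so `φ_{p_c}({0})^{2d} > 2` (Bernoulli) and the cap
  forces `T < 2d` (`depthCap_lt_two_mul`); `T ≤ 13` at `d = 10`, `T ≤ 14` at `d = 11`
  (`depthCap_ten/eleven`). The paper instead takes `T = T(η, d)` LARGE (p. 25) and then `L ≥ L₃(η,T,𝐂,d)`.
* F3 — EQUAL-TIME COUPLING, same proof (p. 25, TeX l.1109): "`X^u_T` and `X^v_T` can be coupled to
  coincide with probability larger than `1 - η/2^{d+2}`" (`η = 1/4` in the proof of Corollary 3.7,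
  p. 22), used in particular "when `u` and `v` are at distance 1" (p. 25, TeX l.1124). With `J = J_NN`
  the walk is the simple random walk on the bipartite graph `ℤ^d`: two walks of equal length started
  at ADJACENT sites never occupy the same site (`walk_end_ne_of_adj`, a parity count), so for such
  `u, v` every coupling has `P[X^u_T = X^v_T] = 0` for every `T` — the printed bound cannot hold at
  distance 1, whatever `T`.

These are facts about the printed inequalities with nearest-neighbour inputs, proved from tree
theorems only (`φ_p({0}) = 2dp`, `p_c(ℤ^d) ≥ 1/(2d-1)`, adjacency in `ℤ^d`). They say that the scheme
AS PRINTED has no nearest-neighbour instance at any `d`; they do not say that no modification of the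
φ_β method can work for the nearest-neighbour model, and the paper does not claim one does.

ABSOLUTE RULE respected: nothing of the paper is asserted or used as a hypothesis; it contributes only
the SHAPES of three displayed inequalities, typed as `def … : Prop` / `def … : ℝ` with their locators.
-/

noncomputable section

namespace Literature.Probability.DuminilCopinPanis2025

open Literature.Probability.LatticeModels (Site zdGraph zdGraph_adj_iff)
open Literature.Probability.Percolation

variable {d : ℕ}

/-! ## §1. The three printed levers, as real-number statements -/

/-- The per-level gain of the block induction of Lemma 3.5: `θ_d := 1 - 1/(4d²)`, the right end of
display (3.21) and the ratio in (3.20)/(3.22) (arXiv v2 p. 21; TeX l.970–978).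
[cite: DuminilCopinPanis2025Percolation, Lemma 3.5 (proof, displays (3.20)–(3.22), arXiv v2 p. 21)] -/
def contractionFactor (d : ℕ) : ℝ := 1 - 1 / (4 * (d : ℝ) ^ 2)

/-- The block-induction step (3.21) of the proof of Lemma 3.5 as an inequality on the value
`Φ = φ_β(B)` of the block `B = Λ_{v₁-1}(v)`: "`Σ_{r ∈ B, s ∉ B ∪ H⁻} P_β[v ↔_B r] p_{rs,β} ≤
(2d-1)/(2d) φ_β(B) ≤ … ≤ θ`" with the paper's `θ = 1 - 1/(4d²)`; we keep `θ` free because any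
`θ < 1` would serve the induction (arXiv v2 p. 21; TeX l.976–978).
[cite: DuminilCopinPanis2025Percolation, Lemma 3.5 (proof, display (3.21), arXiv v2 p. 21)] -/
def BlockStep (d : ℕ) (θ Φ : ℝ) : Prop :=
  (2 * d - 1) / (2 * d) * Φ ≤ θ

/-- The depth cap of the iterated Simon–Lieb inequality in the proof of Proposition 3.6: with
`φ := φ_β({0})` and `T = T(η, d)` the coupling time, "`φ^T ≤ 2`" (arXiv v2 p. 25; TeX l.1120).
[cite: DuminilCopinPanis2025Percolation, Proposition 3.6 (proof, choice of L₃: φ^T ≤ 2, arXiv v2 p. 25)] -/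
def DepthCap (φ : ℝ) (T : ℕ) : Prop :=
  φ ^ T ≤ 2

/-! ## §2. F1 — the block step at the singleton blocks, nearest-neighbour model -/

/-- `φ_p({0}) = 2d·p` on nearest-neighbour `ℤ^d` (the tree's `DKT20.phi_singleton_zero`, reordered).
[cite: DuminilCopinTassionEM2016, §1 (definition of φ_p(S))] -/
theorem phi_singleton_eq (q : unitInterval) :
    DCT16.phi q ({0} : Finset (Site d)) = 2 * d * (q : ℝ) := by
  rw [DKT20.phi_singleton_zero]; ring

/-- At a singleton block the step (3.21) reads `(2d-1)·p ≤ θ`: the left-hand side of (3.21) for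
`B = {v}` is exactly `(2d-1) p = (2d-1)/(2d) · φ_p({0})`. [folklore] -/
theorem blockStep_singleton_iff (hd : 1 ≤ d) (θ : ℝ) (q : unitInterval) :
    BlockStep d θ (DCT16.phi q ({0} : Finset (Site d))) ↔ (2 * d - 1) * (q : ℝ) ≤ θ := by
  have hd' : (0 : ℝ) < 2 * d := by
    have : (1 : ℝ) ≤ d := by exact_mod_cast hd
    linarith
  unfold BlockStep
  have key : (2 * d - 1) / (2 * d) * (2 * d * (q : ℝ)) = (2 * d - 1) * (q : ℝ) := by
    rw [div_mul_eq_mul_div, div_eq_iff hd'.ne']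
    ring
  rw [phi_singleton_eq, key]

/-- **F1, quantitative form.** For every `θ` and every density `p > θ/(2d-1)` the block step (3.21)
fails at the singleton blocks (`v₁ = 1`) of nearest-neighbour `ℤ^d`, `d ≥ 1`. [folklore] -/
theorem not_blockStep_singleton_of_lt (hd : 1 ≤ d) {θ : ℝ} {q : unitInterval}
    (hq : θ / (2 * d - 1) < (q : ℝ)) :
    ¬ BlockStep d θ (DCT16.phi q ({0} : Finset (Site d))) := by
  have h1 : (0 : ℝ) < 2 * d - 1 := by
    have : (1 : ℝ) ≤ d := by exact_mod_cast hd
    linarith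
  rw [blockStep_singleton_iff hd, not_le]
  rwa [div_lt_iff₀ h1, mul_comm] at hq

/-- For `θ < 1` the threshold `θ/(2d-1)` lies strictly below `p_c(ℤ^d) ≥ 1/(2d-1)`
(`inv_le_criticalProbI`), `d ≥ 1`. [folklore] -/
theorem threshold_lt_criticalProbI (hd : 1 ≤ d) {θ : ℝ} (hθ : θ < 1) :
    θ / (2 * d - 1) < (criticalProbI d : ℝ) := by
  have h1 : (0 : ℝ) < 2 * d - 1 := by
    have : (1 : ℝ) ≤ d := by exact_mod_cast hd
    linarith
  calc θ / (2 * d - 1) < 1 / (2 * d - 1) := div_lt_div_of_pos_right hθ h1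
    _ ≤ (criticalProbI d : ℝ) := inv_le_criticalProbI hd

/-- **F1 at `p_c`.** For every `d ≥ 1` and every `θ < 1`, the block step (3.21) with gain `θ` fails at
the singleton blocks of critical nearest-neighbour percolation: `(2d-1) p_c ≥ 1 > θ`. In particular no
contraction factor whatsoever is available at `v₁ = 1`. [folklore] -/
theorem not_blockStep_criticalProbI (hd : 1 ≤ d) {θ : ℝ} (hθ : θ < 1) :
    ¬ BlockStep d θ (DCT16.phi (criticalProbI d) ({0} : Finset (Site d))) :=
  not_blockStep_singleton_of_lt hd (threshold_lt_criticalProbI hd hθ)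

/-- **F1, uniform form.** For every `d ≥ 1` and `θ < 1` there is `p₀ < p_c(ℤ^d)` such that the block
step (3.21) with gain `θ` fails at the singleton blocks for EVERY density `p > p₀` — on a whole left
neighbourhood of `p_c`, where the scheme (run at `β < β*(𝐂, L) ≤ β_c`, uniformly) needs it. [folklore] -/
theorem noContraction_near_criticalProbI (hd : 1 ≤ d) {θ : ℝ} (hθ : θ < 1) :
    ∃ p₀ : ℝ, p₀ < (criticalProbI d : ℝ) ∧
      ∀ q : unitInterval, p₀ < (q : ℝ) → ¬ BlockStep d θ (DCT16.phi q ({0} : Finset (Site d))) :=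
  ⟨θ / (2 * d - 1), threshold_lt_criticalProbI hd hθ, fun _ hq => not_blockStep_singleton_of_lt hd hq⟩

/-- The paper's gain is a genuine contraction: `1 - 1/(4d²) < 1` for `d ≥ 1`. [folklore] -/
theorem contractionFactor_lt_one (hd : 1 ≤ d) : contractionFactor d < 1 := by
  unfold contractionFactor
  have : (0 : ℝ) < 4 * (d : ℝ) ^ 2 := by positivity
  have : 0 < 1 / (4 * (d : ℝ) ^ 2) := by positivity
  linarith

/-- With the printed gain the threshold is `θ_d/(2d-1) = (2d+1)/(4d²)` (`4d² - 1 = (2d-1)(2d+1)`),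
`d ≥ 1`. [folklore] -/
theorem contractionFactor_div (hd : 1 ≤ d) :
    contractionFactor d / (2 * d - 1) = (2 * d + 1) / (4 * (d : ℝ) ^ 2) := by
  unfold contractionFactor
  have h1 : (2 * (d : ℝ) - 1) ≠ 0 := by
    have : (1 : ℝ) ≤ d := by exact_mod_cast hd
    linarith
  have h2 : (4 * (d : ℝ) ^ 2) ≠ 0 := by positivity
  rw [div_eq_div_iff h1 h2, sub_mul, one_div_mul_cancel h2]
  ring

/-- **F1 with the printed constant, every `d`.** The step (3.21) with `θ = 1 - 1/(4d²)` fails at the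
singleton blocks for every density `p > (2d+1)/(4d²)`; this threshold is `< 1/(2d-1) ≤ p_c`. [folklore] -/
theorem not_blockStep_printed_of_lt (hd : 1 ≤ d) {q : unitInterval}
    (hq : (2 * d + 1) / (4 * (d : ℝ) ^ 2) < (q : ℝ)) :
    ¬ BlockStep d (contractionFactor d) (DCT16.phi q ({0} : Finset (Site d))) :=
  not_blockStep_singleton_of_lt hd (by rwa [contractionFactor_div hd])

/-- `d = 10`: the printed step fails at the singleton blocks for every `p > 21/400 = 0.0525`, and
`21/400 < 1/19 ≤ p_c(ℤ¹⁰)`. [folklore] -/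
theorem printedThreshold_ten :
    (2 * (10 : ℕ) + 1) / (4 * ((10 : ℕ) : ℝ) ^ 2) = 21 / 400 ∧ (21 / 400 : ℝ) < 1 / 19 ∧
      (1 / 19 : ℝ) ≤ (criticalProbI 10 : ℝ) := by
  refine ⟨by norm_num, by norm_num, ?_⟩
  have h := inv_le_criticalProbI (d := 10) (by norm_num)
  norm_num at h
  exact h

/-- `d = 11`: the printed step fails at the singleton blocks for every `p > 23/484 = 0.04752…`, and
`23/484 < 1/21 ≤ p_c(ℤ¹¹)`. [folklore] -/
theorem printedThreshold_eleven :
    (2 * (11 : ℕ) + 1) / (4 * ((11 : ℕ) : ℝ) ^ 2) = 23 / 484 ∧ (23 / 484 : ℝ) < 1 / 21 ∧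
      (1 / 21 : ℝ) ≤ (criticalProbI 11 : ℝ) := by
  refine ⟨by norm_num, by norm_num, ?_⟩
  have h := inv_le_criticalProbI (d := 11) (by norm_num)
  norm_num at h
  exact h

/-! ## §3. F2 — the Simon–Lieb depth cap, nearest-neighbour model -/

/-- `φ_{p_c}({0}) = 2d p_c ≥ 2d/(2d-1) = 1 + 1/(2d-1)` on nearest-neighbour `ℤ^d`, `d ≥ 1`. [folklore] -/
theorem one_add_inv_le_phi_criticalProbI (hd : 1 ≤ d) :
    1 + 1 / (2 * d - 1 : ℝ) ≤ DCT16.phi (criticalProbI d) ({0} : Finset (Site d)) := by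
  have hd1 : (1 : ℝ) ≤ d := by exact_mod_cast hd
  have h1 : (0 : ℝ) < 2 * d - 1 := by linarith
  have hpc := inv_le_criticalProbI hd
  rw [phi_singleton_eq]
  have : 1 + 1 / (2 * d - 1 : ℝ) = 2 * d * (1 / (2 * d - 1)) := by
    field_simp; ring
  rw [this]
  exact mul_le_mul_of_nonneg_left hpc (by linarith)

/-- `φ_{p_c}({0})^{2d} > 2`: `(1 + 1/(2d-1))^{2d} ≥ 1 + 2d/(2d-1) > 2` (Bernoulli), `d ≥ 1`. [folklore] -/
theorem two_lt_phi_criticalProbI_pow (hd : 1 ≤ d) :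
    2 < DCT16.phi (criticalProbI d) ({0} : Finset (Site d)) ^ (2 * d) := by
  have hd1 : (1 : ℝ) ≤ d := by exact_mod_cast hd
  have h1 : (0 : ℝ) < 2 * d - 1 := by linarith
  set a : ℝ := 1 / (2 * d - 1) with ha
  have ha0 : 0 < a := by rw [ha]; positivity
  have hφ := one_add_inv_le_phi_criticalProbI hd
  have hbern : 1 + (2 * d : ℕ) * a ≤ (1 + a) ^ (2 * d) :=
    one_add_mul_le_pow (by linarith) (2 * d)
  have hgt : (2 : ℝ) < 1 + (2 * d : ℕ) * a := by
    have : (2 * d : ℕ) * a = 2 * d / (2 * d - 1) := by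
      rw [ha]; push_cast; ring
    rw [this, lt_div_iff₀ h1] at *
    have : (2 : ℝ) - 1 < 2 * d / (2 * d - 1) := by
      rw [lt_div_iff₀ h1]; linarith
    linarith
  calc (2 : ℝ) < (1 + a) ^ (2 * d) := hgt.trans_le hbern
    _ ≤ DCT16.phi (criticalProbI d) ({0} : Finset (Site d)) ^ (2 * d) :=
        pow_le_pow_left₀ (by linarith) hφ _

/-- **F2.** At `p_c` of nearest-neighbour `ℤ^d` (`d ≥ 1`) the depth cap `φ_β({0})^T ≤ 2` of the proof
of Proposition 3.6 forces `T < 2d`: fewer Simon–Lieb iterations than twice the dimension, whereas the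
paper takes `T = T(η, d)` large first and `L` large afterwards. [folklore] -/
theorem depthCap_lt_two_mul (hd : 1 ≤ d) {T : ℕ}
    (hT : DepthCap (DCT16.phi (criticalProbI d) ({0} : Finset (Site d))) T) : T < 2 * d := by
  by_contra h
  rw [not_lt] at h
  have hφ1 : (1 : ℝ) ≤ DCT16.phi (criticalProbI d) ({0} : Finset (Site d)) := by
    have := one_add_inv_le_phi_criticalProbI hd
    have hd1 : (1 : ℝ) ≤ d := by exact_mod_cast hd
    have : (0 : ℝ) ≤ 1 / (2 * d - 1) := by
      have : (0 : ℝ) < 2 * d - 1 := by linarith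
      positivity
    linarith
  have := two_lt_phi_criticalProbI_pow hd
  have hmono := pow_le_pow_right₀ hφ1 h
  unfold DepthCap at hT
  linarith

/-- `d = 10`: `φ_{p_c}({0}) ≥ 20/19` and `(20/19)^14 > 2`, so the cap forces `T ≤ 13`. [folklore] -/
theorem depthCap_ten {T : ℕ}
    (hT : DepthCap (DCT16.phi (criticalProbI 10) ({0} : Finset (Site 10))) T) : T ≤ 13 := by
  by_contra h
  have h14 : 14 ≤ T := by omega
  have hφ : (20 / 19 : ℝ) ≤ DCT16.phi (criticalProbI 10) ({0} : Finset (Site 10)) := by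
    have := one_add_inv_le_phi_criticalProbI (d := 10) (by norm_num)
    norm_num at this ⊢
    exact this
  have hpow : (20 / 19 : ℝ) ^ 14 ≤ DCT16.phi (criticalProbI 10) ({0} : Finset (Site 10)) ^ 14 :=
    pow_le_pow_left₀ (by norm_num) hφ 14
  have hmono : DCT16.phi (criticalProbI 10) ({0} : Finset (Site 10)) ^ 14 ≤
      DCT16.phi (criticalProbI 10) ({0} : Finset (Site 10)) ^ T :=
    pow_le_pow_right₀ (le_trans (by norm_num) hφ) h14
  have h2 : (2 : ℝ) < (20 / 19 : ℝ) ^ 14 := by norm_num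
  unfold DepthCap at hT
  linarith

/-- `d = 11`: `φ_{p_c}({0}) ≥ 22/21` and `(22/21)^15 > 2`, so the cap forces `T ≤ 14`. [folklore] -/
theorem depthCap_eleven {T : ℕ}
    (hT : DepthCap (DCT16.phi (criticalProbI 11) ({0} : Finset (Site 11))) T) : T ≤ 14 := by
  by_contra h
  have h15 : 15 ≤ T := by omega
  have hφ : (22 / 21 : ℝ) ≤ DCT16.phi (criticalProbI 11) ({0} : Finset (Site 11)) := by
    have := one_add_inv_le_phi_criticalProbI (d := 11) (by norm_num)
    norm_num at this ⊢
    exact this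
  have hpow : (22 / 21 : ℝ) ^ 15 ≤ DCT16.phi (criticalProbI 11) ({0} : Finset (Site 11)) ^ 15 :=
    pow_le_pow_left₀ (by norm_num) hφ 15
  have hmono : DCT16.phi (criticalProbI 11) ({0} : Finset (Site 11)) ^ 15 ≤
      DCT16.phi (criticalProbI 11) ({0} : Finset (Site 11)) ^ T :=
    pow_le_pow_right₀ (le_trans (by norm_num) hφ) h15
  have h2 : (2 : ℝ) < (22 / 21 : ℝ) ^ 15 := by norm_num
  unfold DepthCap at hT
  linarith

/-! ## §4. F3 — no equal-time coupling of nearest-neighbour walks from adjacent sites -/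

/-- The parity of a site of `ℤ^d`: `Σ_i x_i mod 2` (the bipartition class of the nearest-neighbour
graph). [folklore] -/
def siteParity (x : Site d) : ZMod 2 := ((∑ i, x i : ℤ) : ZMod 2)

/-- Adjacent sites of `ℤ^d` have opposite parity. [folklore] -/
theorem siteParity_adj {x y : Site d} (h : (zdGraph d).Adj x y) : siteParity y = siteParity x + 1 := by
  have hsum : ∀ (z : Site d) (i : Fin d),
      ∑ j, (z + Pi.single i 1 : Site d) j = (∑ j, z j) + 1 := by
    intro z i
    simp only [Pi.add_apply, Finset.sum_add_distrib, Finset.sum_pi_single', Finset.mem_univ,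
      if_true]
  obtain ⟨i, h | h⟩ := (zdGraph_adj_iff x y).1 h
  · unfold siteParity
    rw [h, hsum]; push_cast; ring
  · unfold siteParity
    rw [h, hsum]; push_cast
    have : (1 : ZMod 2) + 1 = 0 := by decide
    linear_combination -this

/-- Along a nearest-neighbour walk the parity advances by the length: `π(end) = π(start) + length`.
[folklore] -/
theorem siteParity_walk {u x : Site d} (w : (zdGraph d).Walk u x) :
    siteParity x = siteParity u + (w.length : ZMod 2) := by
  induction w with
  | nil => simp
  | cons h p ih =>
    rw [ih, siteParity_adj h, SimpleGraph.Walk.length_cons]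
    push_cast; ring

/-- **F3.** Two nearest-neighbour walks of the SAME length started at ADJACENT sites of `ℤ^d` end at
different sites. Hence for the simple random walks `X^u, X^v` from `u ∼ v` and every coupling,
`P[X^u_T = X^v_T] = 0` for every `T` — the equal-time coupling "with probability larger than
`1 - η/2^{d+2}`" of the proof of Proposition 3.6 (arXiv v2 p. 25), used there in particular for `u, v`
at distance `1`, has no nearest-neighbour instance. [folklore] -/
theorem walk_end_ne_of_adj {u v x y : Site d} (huv : (zdGraph d).Adj u v)
    (w₁ : (zdGraph d).Walk u x) (w₂ : (zdGraph d).Walk v y) (hlen : w₁.length = w₂.length) :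
    x ≠ y := by
  intro hxy
  subst hxy
  have h₁ := siteParity_walk w₁
  have h₂ := siteParity_walk w₂
  rw [siteParity_adj huv, ← hlen] at h₂
  rw [h₁] at h₂
  have h01 : (0 : ZMod 2) = 1 := by
    have := h₂
    linear_combination this
  exact absurd h01 (by decide)

end Literature.Probability.DuminilCopinPanis2025
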